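/-
Copyright (c) 2026 the pub-hodgecm-mathlib formalisation cell (harness21).  Prover seat hodgecm-mathlib-K2E1-p13 (g4) for R90-TF section S8 «ContSpec-n½» (planner R90-CS-plan (g2),
S8-R19 «J2′-1», after K2E1-p10 (g3)'s census∕handoff): the `χ`-WEIGHTED twin at COMPLEX `z` of ★ `K2E1IntertwiningScalarEulerProductU2`, hypothesis-first over the letters (ω)(W)(T).
-/
import Summits.HodgeConjecture.HodgeConjecture.Theorems.K2E1IntertwiningScalarEulerProductU2         -- ★ the `χ = 1`, real-`σ` template; brings ★ LineIntegralU2, ★ LocalFactorU2Line, ★ AdelicProductIntegralOne, ★ ContinuationU2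
import Summits.HodgeConjecture.HodgeConjecture.Theorems.K2E1ChiIntertwiningScalarEulerQuotientU2      -- ★ p861632: `hasProd_chiLocalScalar` (`∏'_{v∉S} = L^S(2z−1,ε)∕L^S(2z,ε)`)
import Summits.HodgeConjecture.HodgeConjecture.Theorems.K2E1ChiIntertwiningLocalFactorHolomorphicU2  -- ★ p861744: `differentiableOn_chiLocalMean`, `differentiableOn_chiArchMean` (token shapes of `m_v`, `c_∞`)
import Summits.HodgeConjecture.HodgeConjecture.Theorems.K2E1WhittakerCoefficientEulerProductU3B      -- ★ generic §0: `continuous_finprod_localFactor` (a factorizable function with continuous factors is continuous)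
import Summits.HodgeConjecture.HodgeConjecture.Theorems.K2E1BorelEisensteinUDefs                      -- ★ `flatSectionU φ z g = φ g · H(g)^z`
import HarnessLib

/-!
# K2·E1 ∕ R90·S8 — `K2E1ChiIntertwiningScalarEulerProductU2` (road J2′-1): THE EULER PRODUCT OF THE `χ`-TWISTED `U(J₂)` INTERTWINING SCALAR AT COMPLEX `z` —
# `ν(𝓕)⁻¹·∫_{N(𝔸)} f_z(w₀ v) dν = c_∞(z) · (∏_{v∈S} m_v(z)) · L^S(2z−1, ε)∕L^S(2z, ε)`, `1 < Re z`, HYPOTHESIS-FIRST over the local weight letters (ω), (W), (T)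

Cell `pub/hodgecm-mathlib`, crux h413 = `stmt-HodgeConjecture-24833`, route `HCCMUnconditional`; R90-TF section S8, road J2′ of the socket `sock_S8_ext_kysCentreU2` (`Cruxes/H413/Lines/
R90_S8_ContSpecIndexA.lean` §4): J2′-1 = the GLOBAL half (this file), J2′-2 = the LOCAL letters (★ `K2E1ChiLocalWeight{Nonsplit,Shell,Token,Continuous}U2`).  THEOREMS ONLY (no `def`,
no `instance`, no notation, no named-fact hypothesis, no `sorry`; default heartbeats); lane `--supports stmt-HodgeConjecture-24833 --as helper` (count-neutral).  Closes no socket.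
THE MATHEMATICS ([MoeglinWaldspurger1995] II.1.6; [Langlands1976] Appendix; [TateThesis1967] Thm 3.3.1, 4.1.3; [Rogawski1990] §13.9 p. 229).  CM pair `L∕L⁺`, `δ ∈ L⁻ ∖ 0`, `N = 2`,
`w₀ = weylLongU`, `f_z = flatSectionU φ z = φ·H^z` for `φ : G(𝔸) → ℂ` (the values of a `χ`-section).  Along the big-cell line `Φ(s,b) = n(θ(ι⁻¹ s, b))`, ★ `H(w₀Φ(s,b)) = A(s)⁻¹·h_f(b)⁻¹`,
so `H^z = A^{−z}·h_f^{−z}`, `h_f(b)^{−z} = ∏ᶠ_v P_v(b_v)^{−z}` (§1–§2); the WEIGHT `φ(w₀Φ(s,b))` (torus part of the Iwasawa decomposition of `w₀ n(·)`, a LOCAL datum) enters through LETTERS: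
(ω) `ω_v : L⁺_v → ℂ` continuous, `‖ω_v‖ ≤ 1`, `ω_v = 1` on `𝒪_v` off `S`;  (W) `φ(w₀Φ(s,b)) = ω_∞(s)·∏ᶠ_v ω_v(b_v)`;  (T) off `S`: `ν_v(𝒪_v)⁻¹·∫ ω_v·P_v^{−z} dν_v = (1 − ε_v q_v^{−2z})(1 − ε_v q_v^{−(2z−1)})⁻¹`
(`ε_v = ε.valueAtUniformizer v`, ★ `hasProd_chiLocalScalar`'s token).  THEN (§3 Tate's theorem for the factorizable integrand, dominated by `h_f^{−Re z} ∈ L¹` ★; §4 splitting off `S`; §5 the ★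
`𝔸_F`-reading + `μ_A(D) = μ_E(D_∞)·μ_f(𝒪̂)` + Fubini), for `1 < Re z`:
  **`ν(𝓕)⁻¹ · ∫_{N(𝔸)} f_z(w₀ v) dν(v) = [μ_E(D_∞)⁻¹·∫ ω_∞·A^{−z} dμ_E] · (∏_{v ∈ S} ν_v(𝒪_v)⁻¹·∫ ω_v·P_v^{−z} dν_v) · L^S(2z−1, ε)∕L^S(2z, ε)`**   (HEAD `inv_measure_mul_chiIntertwiningScalar_eq_eulerProduct`)
— the right-hand side of ★ `K2E1ChiScatteringEulerQuotientU2`'s letter `hsrc` with `A := c_∞·∏_{v∈S} m_v`, holomorphic on `{½ < Re}` (`differentiableOn_chiArchMean_mul_prod_chiLocalMean`).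
HONEST SCOPE.  NOT here: the letters (ω)(W)(T) themselves (road J2′-2); the identification of the left-hand side with a package coordinate `q(z)` (★ `K2E1ChiIntertwinedSectionU2` at `g = 1`).
HONEST LABEL: HC_CM is proved only modulo the 7 printed citations (2 remaining named inputs: hLiu418 = `stmt-HodgeConjecture-24832`, h413 = `stmt-HodgeConjecture-24833`) until rung 0
closes; REL ≠ ★ ≠ BUILT; this file asserts no named fact and closes no socket; count-neutral.

## References
* [MoeglinWaldspurger1995] C. Mœglin, J.-L. Waldspurger, *Spectral Decomposition and Eisenstein Series* (1995), II.1.6, IV.1.11.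
* [Langlands1976] R. P. Langlands, *On the Functional Equations Satisfied by Eisenstein Series*, LNM 544 (1976), Appendix.
* [TateThesis1967] J. Tate, *Fourier analysis in number fields and Hecke's zeta-functions*, in Cassels–Fröhlich (1967), Thm 3.3.1, Thm 4.1.3.
* [Rogawski1990] J. D. Rogawski, *Automorphic Representations of Unitary Groups in Three Variables* (1990), §13.9 p. 229 (`M(s)` as an `L`-quotient), Prop. 11.2.1.
-/

set_option autoImplicit false
set_option linter.dupNamespace false -- the mandated namespace repeats `HodgeConjecture.HodgeConjecture`

noncomputable section

open MeasureTheory Measure NumberField NumberField.InfinitePlace NumberField.mixedEmbedding IsDedekindDomain IsDedekindDomain.HeightOneSpectrum Set Filter Function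
open scoped ENNReal NNReal Classical
open Literature.NumberTheory.GaloisRepresentations.IsNonarchimedeanLocalField
open Literature.NumberTheory.Automorphic Literature.NumberTheory.Automorphic.UnitaryGroup AdelicGroupData Literature.NumberTheory.LFunctions Literature.NumberTheory.GaloisRepresentations
open Summit.HodgeConjecture.HodgeConjecture.Cruxes.H413
open Summit.HodgeConjecture.HodgeConjecture.Cruxes.H413.K2E1BorelEisensteinU
open Summit.HodgeConjecture.HodgeConjecture.Cruxes.H413.K2E1IntertwiningLocalFactorU2Line
open Summit.HodgeConjecture.HodgeConjecture.Cruxes.H413.K2E1IntertwiningScalarEulerProductU2 (one_le_localHeight)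
open Summit.HodgeConjecture.HodgeConjecture.Cruxes.H413.K2E1ChiIntertwiningScalarEulerQuotientU2 (hasProd_chiLocalScalar)
open Summit.HodgeConjecture.HodgeConjecture.Cruxes.H413.AdelicProductIntegralOne (hasProd_localIntegral_of_integrable_one)
open Summit.HodgeConjecture.HodgeConjecture.Cruxes.H413.K2E1WhittakerCoefficientEulerProductU3B (continuous_finprod_localFactor)
open Summit.HodgeConjecture.HodgeConjecture.Cruxes.H413.K2E1IntertwiningScalarLineIntegralU2
open Summit.HodgeConjecture.HodgeConjecture.Cruxes.H413.K2E1HeightBigCellLineFormulaU2 (one_le_coe_finprod_line_cm_two)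
open Summit.HodgeConjecture.HodgeConjecture.Cruxes.H413.K2E1ChiIntertwiningLocalFactorHolomorphicU2 (differentiableOn_chiLocalMean differentiableOn_chiArchMean)

namespace Summit.HodgeConjecture.HodgeConjecture.Cruxes.H413.K2E1ChiIntertwiningScalarEulerProductU2

/-! ## §1 Generic: `x ↦ ((x : ℝ) : ℂ) ^ w` is multiplicative on `ℝ≥0`; norms of finite products of sub-unit factors -/

section Generic

/-- `x ↦ ((x : ℝ) : ℂ) ^ w` is multiplicative on `ℝ≥0` (`Complex.mul_cpow_ofReal_nonneg`). [folklore] -/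
theorem coe_mul_cpow (w : ℂ) (x y : ℝ≥0) : (((x * y : ℝ≥0) : ℝ) : ℂ) ^ w = (((x : ℝ) : ℂ) ^ w) * (((y : ℝ) : ℂ) ^ w) := by
  rw [NNReal.coe_mul, Complex.ofReal_mul]
  exact Complex.mul_cpow_ofReal_nonneg x.2 y.2 w

/-- **`(∏ᶠ_i x_i)^w = ∏ᶠ_i x_i^w` on `ℝ≥0` with a complex exponent** (finite support; the map is a monoid hom). [folklore] -/
theorem map_finprod_coe_cpow {α : Type*} (w : ℂ) {x : α → ℝ≥0} (hx : (mulSupport x).Finite) :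
    ((((∏ᶠ i, x i : ℝ≥0) : ℝ) : ℂ) ^ w) = ∏ᶠ i, (((x i : ℝ) : ℂ) ^ w) := by
  set φ : ℝ≥0 →* ℂ := ⟨⟨fun t => ((t : ℝ) : ℂ) ^ w, by rw [NNReal.coe_one, Complex.ofReal_one, Complex.one_cpow]⟩, fun s t => coe_mul_cpow w s t⟩ with hφ
  exact φ.map_finprod hx

/-- For a real `a > 0`: `((a⁻¹ : ℝ) : ℂ) ^ w = ((a : ℝ) : ℂ) ^ (−w)`. [folklore] -/
theorem ofReal_inv_cpow {a : ℝ} (ha : 0 < a) (w : ℂ) : (((a⁻¹ : ℝ)) : ℂ) ^ w = ((a : ℂ)) ^ (-w) := by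
  rw [Complex.ofReal_inv, Complex.inv_cpow _ _ (by rw [Complex.arg_ofReal_of_nonneg ha.le]; exact Real.pi_ne_zero.symm), Complex.cpow_neg]

/-- **A finite product of factors of norm `≤ 1` has norm `≤ 1`** (and `∏ᶠ = 1` if the support is infinite). [folklore] -/
theorem norm_finprod_le_one {α : Type*} (g : α → ℂ) (hg : ∀ a, ‖g a‖ ≤ 1) : ‖∏ᶠ a, g a‖ ≤ 1 := by
  by_cases hfin : (mulSupport g).Finite
  · rw [finprod_eq_prod g hfin]
    exact (Finset.norm_prod_le _ _).trans (Finset.prod_le_one (fun a _ => norm_nonneg _) fun a _ => hg a)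
  · rw [finprod_of_infinite_mulSupport hfin, norm_one]

end Generic

variable (L : Type) [Field L] [NumberField L] [IsCMField L]
  (hij : (((0 : Fin 2) : ℕ)) + 1 = ((1 : Fin 2) : ℕ)) (hN : 2 = 2 * ((0 : Fin 2) : ℕ) + 2)
  {δ : L} (hcδ : IsCMField.complexConj L δ = -δ) (hδ : δ ≠ 0)
  [∀ v : HeightOneSpectrum (𝓞 ↥(maximalRealSubfield L)), MeasurableSpace (v.adicCompletion ↥(maximalRealSubfield L))]
  [∀ v : HeightOneSpectrum (𝓞 ↥(maximalRealSubfield L)), BorelSpace (v.adicCompletion ↥(maximalRealSubfield L))]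
  (νv : ∀ v : HeightOneSpectrum (𝓞 ↥(maximalRealSubfield L)), Measure (v.adicCompletion ↥(maximalRealSubfield L))) [∀ v, (νv v).IsAddHaarMeasure]
  (ω : ∀ v : HeightOneSpectrum (𝓞 ↥(maximalRealSubfield L)), v.adicCompletion ↥(maximalRealSubfield L) → ℂ)
  {z : ℂ}

/-! ## §2 The local weight factor `ω_v(x)·P_v(x)^{−z}` -/

omit [IsCMField L] [∀ v : HeightOneSpectrum (𝓞 ↥(maximalRealSubfield L)), MeasurableSpace (v.adicCompletion ↥(maximalRealSubfield L))] [∀ v : HeightOneSpectrum (𝓞 ↥(maximalRealSubfield L)), BorelSpace (v.adicCompletion ↥(maximalRealSubfield L))] in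
/-- **`x ↦ ω_v(x)·P_v(x)^{−z}` is continuous** when `ω_v` is (`P_v > 0` lies in the slit plane; ★ `continuous_prod_extension_max_one`). [folklore] -/
theorem continuous_localWeightFactor (hωc : ∀ v, Continuous (ω v)) (z : ℂ) (v : HeightOneSpectrum (𝓞 ↥(maximalRealSubfield L))) :
    Continuous fun x : v.adicCompletion ↥(maximalRealSubfield L) => ω v x * ((((letI := Extension.fintype (𝓞 ↥(maximalRealSubfield L)) ↥(maximalRealSubfield L) L (𝓞 L) v; ∏ w : v.Extension (𝓞 L), max 1 (normAbs (w.1.adicCompletion L) (Extension.adicCompletionSemialgHom ↥(maximalRealSubfield L) L w x) * normAbs (w.1.adicCompletion L) ((algebraMap L (FiniteAdeleRing (𝓞 L) L) δ) w.1))) : ℝ≥0) : ℝ) : ℂ) ^ (-z) := by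
  refine (hωc v).mul (Continuous.cpow ?_ continuous_const fun x => Complex.ofReal_mem_slitPlane.2 ?_)
  · exact Complex.continuous_ofReal.comp (NNReal.continuous_coe.comp (continuous_prod_extension_max_one (E := L) (δ := δ) v))
  · exact lt_of_lt_of_le zero_lt_one (by exact_mod_cast one_le_localHeight L v x)

omit [IsCMField L] [∀ v : HeightOneSpectrum (𝓞 ↥(maximalRealSubfield L)), MeasurableSpace (v.adicCompletion ↥(maximalRealSubfield L))] [∀ v : HeightOneSpectrum (𝓞 ↥(maximalRealSubfield L)), BorelSpace (v.adicCompletion ↥(maximalRealSubfield L))] in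
/-- **Off `S` the local weight factor is `1` on `𝒪_v`** (letter (ω): `ω_v = 1` there; ★ `prod_extension_max_one_eq_one_of_mem_integers`: `P_v = 1` there since `S ⊇ S_δ`). [cite: TateThesis1967, Thm 3.3.1] -/
theorem localWeightFactor_eq_one_of_mem_integers (z : ℂ) (S : Finset (HeightOneSpectrum (𝓞 ↥(maximalRealSubfield L))))
    (hS : ∀ v ∉ S, ∀ w : v.Extension (𝓞 L), normAbs (w.1.adicCompletion L) ((algebraMap L (FiniteAdeleRing (𝓞 L) L) δ) w.1) = 1)
    (hω1 : ∀ v ∉ S, ∀ x ∈ v.adicCompletionIntegers ↥(maximalRealSubfield L), ω v x = 1)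
    {v : HeightOneSpectrum (𝓞 ↥(maximalRealSubfield L))} (hv : v ∉ S) {x : v.adicCompletion ↥(maximalRealSubfield L)} (hx : x ∈ v.adicCompletionIntegers ↥(maximalRealSubfield L)) :
    ω v x * ((((letI := Extension.fintype (𝓞 ↥(maximalRealSubfield L)) ↥(maximalRealSubfield L) L (𝓞 L) v; ∏ w : v.Extension (𝓞 L), max 1 (normAbs (w.1.adicCompletion L) (Extension.adicCompletionSemialgHom ↥(maximalRealSubfield L) L w x) * normAbs (w.1.adicCompletion L) ((algebraMap L (FiniteAdeleRing (𝓞 L) L) δ) w.1))) : ℝ≥0) : ℝ) : ℂ) ^ (-z) = 1 := by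
  rw [hω1 v hv x hx, prod_extension_max_one_eq_one_of_mem_integers (E := L) v (hS v hv) hx, NNReal.coe_one, Complex.ofReal_one, Complex.one_cpow, mul_one]

omit [IsCMField L] [∀ v : HeightOneSpectrum (𝓞 ↥(maximalRealSubfield L)), MeasurableSpace (v.adicCompletion ↥(maximalRealSubfield L))] [∀ v : HeightOneSpectrum (𝓞 ↥(maximalRealSubfield L)), BorelSpace (v.adicCompletion ↥(maximalRealSubfield L))] in
/-- Off `S`, `P_v(x)^{−z} = 1` on `𝒪_v` (★ `prod_extension_max_one_eq_one_of_mem_integers`). [folklore] -/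
theorem localHeight_cpow_eq_one_of_mem_integers (z : ℂ) (S : Finset (HeightOneSpectrum (𝓞 ↥(maximalRealSubfield L))))
    (hS : ∀ v ∉ S, ∀ w : v.Extension (𝓞 L), normAbs (w.1.adicCompletion L) ((algebraMap L (FiniteAdeleRing (𝓞 L) L) δ) w.1) = 1)
    {v : HeightOneSpectrum (𝓞 ↥(maximalRealSubfield L))} (hv : v ∉ S) {x : v.adicCompletion ↥(maximalRealSubfield L)} (hx : x ∈ v.adicCompletionIntegers ↥(maximalRealSubfield L)) :
    ((((letI := Extension.fintype (𝓞 ↥(maximalRealSubfield L)) ↥(maximalRealSubfield L) L (𝓞 L) v; ∏ w : v.Extension (𝓞 L), max 1 (normAbs (w.1.adicCompletion L) (Extension.adicCompletionSemialgHom ↥(maximalRealSubfield L) L w x) * normAbs (w.1.adicCompletion L) ((algebraMap L (FiniteAdeleRing (𝓞 L) L) δ) w.1))) : ℝ≥0) : ℝ) : ℂ) ^ (-z) = 1 := by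
  rw [prod_extension_max_one_eq_one_of_mem_integers (E := L) v (hS v hv) hx, NNReal.coe_one, Complex.ofReal_one, Complex.one_cpow]

omit [IsCMField L] [∀ v : HeightOneSpectrum (𝓞 ↥(maximalRealSubfield L)), MeasurableSpace (v.adicCompletion ↥(maximalRealSubfield L))] [∀ v : HeightOneSpectrum (𝓞 ↥(maximalRealSubfield L)), BorelSpace (v.adicCompletion ↥(maximalRealSubfield L))] in
/-- **The local weight factor has norm `≤ P_v(x)^{−Re z} ≤ 1`** for `0 ≤ Re z` (`‖ω_v‖ ≤ 1`, `P_v ≥ 1`). [folklore] -/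
theorem norm_localWeightFactor_le_one (hωb : ∀ v x, ‖ω v x‖ ≤ 1) (hz : 0 ≤ z.re) (v : HeightOneSpectrum (𝓞 ↥(maximalRealSubfield L))) (x : v.adicCompletion ↥(maximalRealSubfield L)) :
    ‖ω v x * ((((letI := Extension.fintype (𝓞 ↥(maximalRealSubfield L)) ↥(maximalRealSubfield L) L (𝓞 L) v; ∏ w : v.Extension (𝓞 L), max 1 (normAbs (w.1.adicCompletion L) (Extension.adicCompletionSemialgHom ↥(maximalRealSubfield L) L w x) * normAbs (w.1.adicCompletion L) ((algebraMap L (FiniteAdeleRing (𝓞 L) L) δ) w.1))) : ℝ≥0) : ℝ) : ℂ) ^ (-z)‖ ≤ 1 := by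
  have h1 : (1 : ℝ) ≤ (((letI := Extension.fintype (𝓞 ↥(maximalRealSubfield L)) ↥(maximalRealSubfield L) L (𝓞 L) v; ∏ w : v.Extension (𝓞 L), max 1 (normAbs (w.1.adicCompletion L) (Extension.adicCompletionSemialgHom ↥(maximalRealSubfield L) L w x) * normAbs (w.1.adicCompletion L) ((algebraMap L (FiniteAdeleRing (𝓞 L) L) δ) w.1))) : ℝ≥0) : ℝ) := by
    exact_mod_cast one_le_localHeight L v x
  rw [norm_mul, Complex.norm_cpow_eq_rpow_re_of_pos (lt_of_lt_of_le zero_lt_one h1), Complex.neg_re]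
  have h2 : (((letI := Extension.fintype (𝓞 ↥(maximalRealSubfield L)) ↥(maximalRealSubfield L) L (𝓞 L) v; ∏ w : v.Extension (𝓞 L), max 1 (normAbs (w.1.adicCompletion L) (Extension.adicCompletionSemialgHom ↥(maximalRealSubfield L) L w x) * normAbs (w.1.adicCompletion L) ((algebraMap L (FiniteAdeleRing (𝓞 L) L) δ) w.1))) : ℝ≥0) : ℝ) ^ (-z.re) ≤ 1 :=
    Real.rpow_le_one_of_one_le_of_nonpos h1 (by linarith)
  calc ‖ω v x‖ * _ ≤ 1 * 1 := by gcongr; exact hωb v x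
    _ = 1 := one_mul 1

/-! ## §3 The factorizable finite integrand `∏ᶠ_v ω_v(b_v)·P_v(b_v)^{−z} = (∏ᶠ_v ω_v(b_v)) · h_f(b)^{−z}`: continuity, domination, Tate's theorem -/

section Finite

variable [MeasurableSpace (FiniteAdeleRing (𝓞 ↥(maximalRealSubfield L)) ↥(maximalRealSubfield L))] [BorelSpace (FiniteAdeleRing (𝓞 ↥(maximalRealSubfield L)) ↥(maximalRealSubfield L))]

omit [∀ v : HeightOneSpectrum (𝓞 ↥(maximalRealSubfield L)), MeasurableSpace (v.adicCompletion ↥(maximalRealSubfield L))] [∀ v : HeightOneSpectrum (𝓞 ↥(maximalRealSubfield L)), BorelSpace (v.adicCompletion ↥(maximalRealSubfield L))] [∀ v, (νv v).IsAddHaarMeasure] [MeasurableSpace (FiniteAdeleRing (𝓞 ↥(maximalRealSubfield L)) ↥(maximalRealSubfield L))] [BorelSpace (FiniteAdeleRing (𝓞 ↥(maximalRealSubfield L)) ↥(maximalRealSubfield L))] in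
/-- **`∏ᶠ_v P_v(b_v)^{−z} = h_f(b)^{−z}`** in `ℂ` at COMPLEX `z` (★ `finprod_max_one_nnnorm_traceZeroLine_snd_eq`: `h_f(b) = ∏ᶠ_v P_v(b_v)` in `ℝ≥0`, finitely supported; §1). [cite: TateThesis1967, Thm 3.3.1] -/
theorem finprod_localHeight_cpow_eq (z : ℂ) (b : FiniteAdeleRing (𝓞 ↥(maximalRealSubfield L)) ↥(maximalRealSubfield L)) :
    (∏ᶠ v : HeightOneSpectrum (𝓞 ↥(maximalRealSubfield L)), ((((letI := Extension.fintype (𝓞 ↥(maximalRealSubfield L)) ↥(maximalRealSubfield L) L (𝓞 L) v; ∏ w : v.Extension (𝓞 L), max 1 (normAbs (w.1.adicCompletion L) (Extension.adicCompletionSemialgHom ↥(maximalRealSubfield L) L w (b v)) * normAbs (w.1.adicCompletion L) ((algebraMap L (FiniteAdeleRing (𝓞 L) L) δ) w.1))) : ℝ≥0) : ℝ) : ℂ) ^ (-z)) =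
      ((((∏ᶠ v : HeightOneSpectrum (𝓞 L), max 1 ‖((traceZeroLine ↥(maximalRealSubfield L) L (IsCMField.complexConj L) hcδ hδ ((0, b) : AdeleRing (𝓞 ↥(maximalRealSubfield L)) ↥(maximalRealSubfield L)) : traceZeroAdele ↥(maximalRealSubfield L) L (IsCMField.complexConj L)) : AdeleRing (𝓞 L) L).2 v‖₊ : ℝ≥0) : ℝ) : ℂ) ^ (-z)) := by
  rw [finprod_max_one_nnnorm_traceZeroLine_snd_eq (IsCMField.complexConj L) hcδ hδ 0 b]
  have hsupp : (mulSupport fun v : HeightOneSpectrum (𝓞 ↥(maximalRealSubfield L)) => (letI := Extension.fintype (𝓞 ↥(maximalRealSubfield L)) ↥(maximalRealSubfield L) L (𝓞 L) v;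
      ∏ w : v.Extension (𝓞 L), max 1 (normAbs (w.1.adicCompletion L) (Extension.adicCompletionSemialgHom ↥(maximalRealSubfield L) L w (b v)) * normAbs (w.1.adicCompletion L) ((algebraMap L (FiniteAdeleRing (𝓞 L) L) δ) w.1)))).Finite := by
    have hS := finite_setOf_exists_extension_normAbs_ne_one (F := ↥(maximalRealSubfield L)) (E := L) hδ
    have hb := b.eventually
    refine (hS.union (Filter.eventually_cofinite.1 hb)).subset fun v hv => ?_
    rw [mem_mulSupport] at hv
    by_contra hnot
    rw [mem_union, not_or, mem_setOf_eq, mem_setOf_eq, not_exists, not_not] at hnot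
    exact hv (prod_extension_max_one_eq_one_of_mem_integers (E := L) v (fun w => not_not.1 (hnot.1 w)) hnot.2)
  exact (map_finprod_coe_cpow (-z) hsupp).symm

omit [∀ v : HeightOneSpectrum (𝓞 ↥(maximalRealSubfield L)), MeasurableSpace (v.adicCompletion ↥(maximalRealSubfield L))] [∀ v : HeightOneSpectrum (𝓞 ↥(maximalRealSubfield L)), BorelSpace (v.adicCompletion ↥(maximalRealSubfield L))] [∀ v, (νv v).IsAddHaarMeasure] [MeasurableSpace (FiniteAdeleRing (𝓞 ↥(maximalRealSubfield L)) ↥(maximalRealSubfield L))] [BorelSpace (FiniteAdeleRing (𝓞 ↥(maximalRealSubfield L)) ↥(maximalRealSubfield L))] in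
/-- **THE FACTORIZABLE INTEGRAND: `∏ᶠ_v ω_v(b_v)·P_v(b_v)^{−z} = (∏ᶠ_v ω_v(b_v)) · h_f(b)^{−z}`** (both supports are finite: `b_v ∈ 𝒪_v` for almost all `v`, and off `S` both factors are `1`
there). [cite: TateThesis1967, Thm 3.3.1] -/
theorem finprod_localWeightFactor_eq (z : ℂ) (S : Finset (HeightOneSpectrum (𝓞 ↥(maximalRealSubfield L))))
    (hS : ∀ v ∉ S, ∀ w : v.Extension (𝓞 L), normAbs (w.1.adicCompletion L) ((algebraMap L (FiniteAdeleRing (𝓞 L) L) δ) w.1) = 1)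
    (hω1 : ∀ v ∉ S, ∀ x ∈ v.adicCompletionIntegers ↥(maximalRealSubfield L), ω v x = 1) (b : FiniteAdeleRing (𝓞 ↥(maximalRealSubfield L)) ↥(maximalRealSubfield L)) :
    (∏ᶠ v : HeightOneSpectrum (𝓞 ↥(maximalRealSubfield L)), ω v (b v) * ((((letI := Extension.fintype (𝓞 ↥(maximalRealSubfield L)) ↥(maximalRealSubfield L) L (𝓞 L) v; ∏ w : v.Extension (𝓞 L), max 1 (normAbs (w.1.adicCompletion L) (Extension.adicCompletionSemialgHom ↥(maximalRealSubfield L) L w (b v)) * normAbs (w.1.adicCompletion L) ((algebraMap L (FiniteAdeleRing (𝓞 L) L) δ) w.1))) : ℝ≥0) : ℝ) : ℂ) ^ (-z)) =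
      (∏ᶠ v : HeightOneSpectrum (𝓞 ↥(maximalRealSubfield L)), ω v (b v)) *
        ((((∏ᶠ v : HeightOneSpectrum (𝓞 L), max 1 ‖((traceZeroLine ↥(maximalRealSubfield L) L (IsCMField.complexConj L) hcδ hδ ((0, b) : AdeleRing (𝓞 ↥(maximalRealSubfield L)) ↥(maximalRealSubfield L)) : traceZeroAdele ↥(maximalRealSubfield L) L (IsCMField.complexConj L)) : AdeleRing (𝓞 L) L).2 v‖₊ : ℝ≥0) : ℝ) : ℂ) ^ (-z)) := by
  -- the common finite exceptional set: `S ∪ {v | b_v ∉ 𝒪_v}`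
  have hb := Filter.eventually_cofinite.1 b.eventually
  have hωfin : (mulSupport fun v : HeightOneSpectrum (𝓞 ↥(maximalRealSubfield L)) => ω v (b v)).Finite := by
    refine ((S : Set (HeightOneSpectrum (𝓞 ↥(maximalRealSubfield L)))).toFinite.union hb).subset fun v hv => ?_
    by_contra hnot
    rw [mem_union, not_or, Finset.mem_coe, mem_setOf_eq, not_not] at hnot
    exact hv (hω1 v hnot.1 _ hnot.2)
  have hPfin : (mulSupport fun v : HeightOneSpectrum (𝓞 ↥(maximalRealSubfield L)) => ((((letI := Extension.fintype (𝓞 ↥(maximalRealSubfield L)) ↥(maximalRealSubfield L) L (𝓞 L) v; ∏ w : v.Extension (𝓞 L), max 1 (normAbs (w.1.adicCompletion L) (Extension.adicCompletionSemialgHom ↥(maximalRealSubfield L) L w (b v)) * normAbs (w.1.adicCompletion L) ((algebraMap L (FiniteAdeleRing (𝓞 L) L) δ) w.1))) : ℝ≥0) : ℝ) : ℂ) ^ (-z)).Finite := by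
    refine ((S : Set (HeightOneSpectrum (𝓞 ↥(maximalRealSubfield L)))).toFinite.union hb).subset fun v hv => ?_
    by_contra hnot
    rw [mem_union, not_or, Finset.mem_coe, mem_setOf_eq, not_not] at hnot
    exact hv (localHeight_cpow_eq_one_of_mem_integers L z S hS hnot.1 hnot.2)
  rw [finprod_mul_distrib hωfin hPfin, finprod_localHeight_cpow_eq L hcδ hδ z b]

omit [∀ v : HeightOneSpectrum (𝓞 ↥(maximalRealSubfield L)), MeasurableSpace (v.adicCompletion ↥(maximalRealSubfield L))] [∀ v : HeightOneSpectrum (𝓞 ↥(maximalRealSubfield L)), BorelSpace (v.adicCompletion ↥(maximalRealSubfield L))] in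
include hij hN hcδ hδ in
/-- **THE FACTORIZABLE INTEGRAND IS `μ_f`-INTEGRABLE FOR `Re z > 1`**: continuous (★ `continuous_finprod_localFactor`, letters (ω)), and dominated by `h_f(b)^{−Re z} ∈ L¹(μ_f)`
(★ `integrable_finFactor_rpow_neg_cm_two` at `σ := Re z`; `‖∏ᶠ ω_v(b_v)‖ ≤ 1`). [cite: TateThesis1967, Thm 3.3.1] [cite: MoeglinWaldspurger1995, II.1.6] -/
theorem integrable_finprod_localWeightFactor (hz : 1 < z.re) (hωc : ∀ v, Continuous (ω v)) (hωb : ∀ v x, ‖ω v x‖ ≤ 1)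
    (μf : Measure (FiniteAdeleRing (𝓞 ↥(maximalRealSubfield L)) ↥(maximalRealSubfield L))) [μf.IsAddHaarMeasure]
    (S : Finset (HeightOneSpectrum (𝓞 ↥(maximalRealSubfield L)))) (hS : ∀ v ∉ S, ∀ w : v.Extension (𝓞 L), normAbs (w.1.adicCompletion L) ((algebraMap L (FiniteAdeleRing (𝓞 L) L) δ) w.1) = 1)
    (hω1 : ∀ v ∉ S, ∀ x ∈ v.adicCompletionIntegers ↥(maximalRealSubfield L), ω v x = 1) :
    Integrable (fun b : FiniteAdeleRing (𝓞 ↥(maximalRealSubfield L)) ↥(maximalRealSubfield L) => ∏ᶠ v : HeightOneSpectrum (𝓞 ↥(maximalRealSubfield L)), ω v (b v) * ((((letI := Extension.fintype (𝓞 ↥(maximalRealSubfield L)) ↥(maximalRealSubfield L) L (𝓞 L) v; ∏ w : v.Extension (𝓞 L), max 1 (normAbs (w.1.adicCompletion L) (Extension.adicCompletionSemialgHom ↥(maximalRealSubfield L) L w (b v)) * normAbs (w.1.adicCompletion L) ((algebraMap L (FiniteAdeleRing (𝓞 L) L) δ) w.1))) : ℝ≥0) : ℝ) : ℂ) ^ (-z))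 μf := by
  haveI : SecondCountableTopology (FiniteAdeleRing (𝓞 ↥(maximalRealSubfield L)) ↥(maximalRealSubfield L)) := secondCountableTopology_finiteAdeleRing ↥(maximalRealSubfield L)
  letI : MeasurableSpace (quasiSplit (↥(maximalRealSubfield L)) L (IsCMField.complexConj L) 2).Adelic := borel _
  haveI : BorelSpace (quasiSplit (↥(maximalRealSubfield L)) L (IsCMField.complexConj L) 2).Adelic := ⟨rfl⟩
  -- continuity: ★ `continuous_finprod_localFactor` at `ι := Unit`
  have hcont : Continuous fun b : FiniteAdeleRing (𝓞 ↥(maximalRealSubfield L)) ↥(maximalRealSubfield L) => ∏ᶠ v : HeightOneSpectrum (𝓞 ↥(maximalRealSubfield L)), ω v (b v) * ((((letI := Extension.fintype (𝓞 ↥(maximalRealSubfield L)) ↥(maximalRealSubfield L) L (𝓞 L) v; ∏ w : v.Extension (𝓞 L), max 1 (normAbs (w.1.adicCompletion L) (Extension.adicCompletionSemialgHom ↥(maximalRealSubfield L) L w (b v)) * normAbs (w.1.adicCompletion L) ((algebraMap L (FiniteAdeleRing (𝓞 L) L) δ) w.1))) : ℝ≥0) : ℝ) : ℂ) ^ (-z)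 := by
    have h := continuous_finprod_localFactor (K := ↥(maximalRealSubfield L)) (ι := Unit)
      (fun v y => ω v (y ()) * ((((letI := Extension.fintype (𝓞 ↥(maximalRealSubfield L)) ↥(maximalRealSubfield L) L (𝓞 L) v; ∏ w : v.Extension (𝓞 L), max 1 (normAbs (w.1.adicCompletion L) (Extension.adicCompletionSemialgHom ↥(maximalRealSubfield L) L w (y ())) * normAbs (w.1.adicCompletion L) ((algebraMap L (FiniteAdeleRing (𝓞 L) L) δ) w.1))) : ℝ≥0) : ℝ) : ℂ) ^ (-z)) S
      (fun v => (continuous_localWeightFactor L ω hωc z v).comp (continuous_apply ()))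
      (fun v hv y hy => localWeightFactor_eq_one_of_mem_integers L ω z S hS hω1 hv ((mem_integralBox_iff.1 hy) ()))
    exact h.comp (continuous_pi fun _ => continuous_id)
  -- domination by `h_f^{−Re z}`
  refine Integrable.mono' ((integrable_finFactor_rpow_neg_cm_two L hij hN hcδ hδ μf hz)) hcont.aestronglyMeasurable (Eventually.of_forall fun b => ?_)
  rw [finprod_localWeightFactor_eq L hcδ hδ ω z S hS hω1 b, norm_mul]
  have hF : (0 : ℝ) < ((∏ᶠ v : HeightOneSpectrum (𝓞 L), max 1 ‖((traceZeroLine ↥(maximalRealSubfield L) L (IsCMField.complexConj L) hcδ hδ ((0, b) : AdeleRing (𝓞 ↥(maximalRealSubfield L)) ↥(maximalRealSubfield L)) : traceZeroAdele ↥(maximalRealSubfield L) L (IsCMField.complexConj L)) : AdeleRing (𝓞 L) L).2 v‖₊ : ℝ≥0) : ℝ) :=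
    lt_of_lt_of_le one_pos (one_le_coe_finprod_line_cm_two L hcδ hδ b)
  rw [Complex.norm_cpow_eq_rpow_re_of_pos hF, Complex.neg_re]
  calc ‖∏ᶠ v : HeightOneSpectrum (𝓞 ↥(maximalRealSubfield L)), ω v (b v)‖ * _ ≤ 1 * _ := by
        gcongr; exact norm_finprod_le_one _ fun v => hωb v (b v)
    _ = _ := one_mul _

include hij hN in
/-- **TATE'S THEOREM FOR THE `χ`-WEIGHTED INTEGRAND — THE EULER PRODUCT OVER ALL `v`**: for `Re z > 1`, every additive Haar `μ_f` on `𝔸_{L⁺,f}`, Haar family `νv`, and every finset `S ⊇ S_δ`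
off which `ω_v = 1` on `𝒪_v`:  `HasProd (v ↦ m_v(z)) (μ_f(𝒪̂)⁻¹ · ∫ (∏ᶠ_v ω_v(b_v))·h_f(b)^{−z} dμ_f(b))`, `m_v(z) = νv(𝒪_v)⁻¹ • ∫ ω_v·P_v^{−z} dνv` (★ (3a)
`hasProd_localIntegral_of_integrable_one`; §2–§3). [cite: TateThesis1967, Thm 3.3.1] [cite: MoeglinWaldspurger1995, II.1.6] -/
theorem hasProd_chiLocalMean (hz : 1 < z.re) (hωc : ∀ v, Continuous (ω v)) (hωb : ∀ v x, ‖ω v x‖ ≤ 1)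
    (μf : Measure (FiniteAdeleRing (𝓞 ↥(maximalRealSubfield L)) ↥(maximalRealSubfield L))) [μf.IsAddHaarMeasure]
    (S : Finset (HeightOneSpectrum (𝓞 ↥(maximalRealSubfield L)))) (hS : ∀ v ∉ S, ∀ w : v.Extension (𝓞 L), normAbs (w.1.adicCompletion L) ((algebraMap L (FiniteAdeleRing (𝓞 L) L) δ) w.1) = 1)
    (hω1 : ∀ v ∉ S, ∀ x ∈ v.adicCompletionIntegers ↥(maximalRealSubfield L), ω v x = 1) :
    HasProd (fun v : HeightOneSpectrum (𝓞 ↥(maximalRealSubfield L)) => ((νv v (v.adicCompletionIntegers ↥(maximalRealSubfield L))).toReal⁻¹ • ∫ x, ω v x * ((((letI := Extension.fintype (𝓞 ↥(maximalRealSubfield L)) ↥(maximalRealSubfield L) L (𝓞 L) v; ∏ w : v.Extension (𝓞 L), max 1 (normAbs (w.1.adicCompletion L) (Extension.adicCompletionSemialgHom ↥(maximalRealSubfield L) L w x) * normAbs (w.1.adicCompletion L) ((algebraMap L (FiniteAdeleRing (𝓞 L) L) δ) w.1))) : ℝ≥0) : ℝ) : ℂ) ^ (-z) ∂νv v))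
      ((μf {b : FiniteAdeleRing (𝓞 ↥(maximalRealSubfield L)) ↥(maximalRealSubfield L) | ∀ v, b v ∈ v.adicCompletionIntegers ↥(maximalRealSubfield L)}).toReal⁻¹ •
        ∫ b, (∏ᶠ v : HeightOneSpectrum (𝓞 ↥(maximalRealSubfield L)), ω v (b v)) *
          ((((∏ᶠ v : HeightOneSpectrum (𝓞 L), max 1 ‖((traceZeroLine ↥(maximalRealSubfield L) L (IsCMField.complexConj L) hcδ hδ ((0, b) : AdeleRing (𝓞 ↥(maximalRealSubfield L)) ↥(maximalRealSubfield L)) : traceZeroAdele ↥(maximalRealSubfield L) L (IsCMField.complexConj L)) : AdeleRing (𝓞 L) L).2 v‖₊ : ℝ≥0) : ℝ) : ℂ) ^ (-z)) ∂μf) := by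
  have h := hasProd_localIntegral_of_integrable_one ↥(maximalRealSubfield L) μf νv
    (fun v x => ω v x * ((((letI := Extension.fintype (𝓞 ↥(maximalRealSubfield L)) ↥(maximalRealSubfield L) L (𝓞 L) v; ∏ w : v.Extension (𝓞 L), max 1 (normAbs (w.1.adicCompletion L) (Extension.adicCompletionSemialgHom ↥(maximalRealSubfield L) L w x) * normAbs (w.1.adicCompletion L) ((algebraMap L (FiniteAdeleRing (𝓞 L) L) δ) w.1))) : ℝ≥0) : ℝ) : ℂ) ^ (-z)) S
    (fun v => continuous_localWeightFactor L ω hωc z v) (fun v hv x hx => localWeightFactor_eq_one_of_mem_integers L ω z S hS hω1 hv hx)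
    (integrable_finprod_localWeightFactor L hij hN hcδ hδ ω hz hωc hωb μf S hS hω1)
  simp_rw [finprod_localWeightFactor_eq L hcδ hδ ω z S hS hω1] at h
  exact h

/-! ## §4 Splitting off `S` with the letter (T): `μ_f(𝒪̂)⁻¹·∫ (∏ᶠ ω_v)·h_f^{−z} dμ_f = (∏_{v∈S} m_v(z)) · L^S(2z−1, ε)∕L^S(2z, ε)` -/

include hij hN in
/-- **THE FINITE PART OF THE `χ`-TWISTED INTERTWINING SCALAR IS AN EULER QUOTIENT**: for `Re z > 1`, a unitary Hecke character `ε` of `L⁺` (read `ε = χ₀`), and the letter (T)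
«off `S` the local mean is ★ p861632's token `(1 − ε_v q_v^{−2z})(1 − ε_v q_v^{−(2z−1)})⁻¹`» (means in ★ p861744's shape `(ν_v(𝒪_v)⁻¹ : ℂ) · ∫ ω_v·P_v^{−z}`):
`μ_f(𝒪̂)⁻¹ · ∫_{𝔸_{L⁺,f}} (∏ᶠ_v ω_v(b_v))·h_f(b)^{−z} dμ_f(b) = (∏_{v ∈ S} m_v(z)) · L^S(2z−1, ε)∕L^S(2z, ε)` (§3, ★ `hasProd_chiLocalScalar`, Mathlib `HasProd.mul_compl`, `HasProd.unique`).
[cite: MoeglinWaldspurger1995, II.1.6] [cite: Langlands1976, Appendix] [cite: Rogawski1990, §13.9 p. 229] -/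
theorem inv_measure_mul_integral_chiFinFactor_eq_eulerProduct (hz : 1 < z.re) (hωc : ∀ v, Continuous (ω v)) (hωb : ∀ v x, ‖ω v x‖ ≤ 1)
    (μf : Measure (FiniteAdeleRing (𝓞 ↥(maximalRealSubfield L)) ↥(maximalRealSubfield L))) [μf.IsAddHaarMeasure]
    (S : Finset (HeightOneSpectrum (𝓞 ↥(maximalRealSubfield L)))) (hS : ∀ v ∉ S, ∀ w : v.Extension (𝓞 L), normAbs (w.1.adicCompletion L) ((algebraMap L (FiniteAdeleRing (𝓞 L) L) δ) w.1) = 1)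
    (hω1 : ∀ v ∉ S, ∀ x ∈ v.adicCompletionIntegers ↥(maximalRealSubfield L), ω v x = 1)
    {ε : HeckeCharacter ↥(maximalRealSubfield L)} (hε : ε.IsUnitary)
    (htok : ∀ v ∉ S, (((((νv v (v.adicCompletionIntegers ↥(maximalRealSubfield L))).toReal⁻¹ : ℝ)) : ℂ) * ∫ x, ω v x * ((((letI := Extension.fintype (𝓞 ↥(maximalRealSubfield L)) ↥(maximalRealSubfield L) L (𝓞 L) v; ∏ w : v.Extension (𝓞 L), max 1 (normAbs (w.1.adicCompletion L) (Extension.adicCompletionSemialgHom ↥(maximalRealSubfield L) L w x) * normAbs (w.1.adicCompletion L) ((algebraMap L (FiniteAdeleRing (𝓞 L) L) δ) w.1))) : ℝ≥0) : ℝ) : ℂ) ^ (-z) ∂νv v) =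
      (1 - ε.valueAtUniformizer v * (v.residueCard : ℂ) ^ (-(2 * z))) * (1 - ε.valueAtUniformizer v * (v.residueCard : ℂ) ^ (-(2 * z - 1)))⁻¹) :
    ((((μf {b : FiniteAdeleRing (𝓞 ↥(maximalRealSubfield L)) ↥(maximalRealSubfield L) | ∀ v, b v ∈ v.adicCompletionIntegers ↥(maximalRealSubfield L)}).toReal⁻¹ : ℝ)) : ℂ) *
        ∫ b, (∏ᶠ v : HeightOneSpectrum (𝓞 ↥(maximalRealSubfield L)), ω v (b v)) *
            ((((∏ᶠ v : HeightOneSpectrum (𝓞 L), max 1 ‖((traceZeroLine ↥(maximalRealSubfield L) L (IsCMField.complexConj L) hcδ hδ ((0, b) : AdeleRing (𝓞 ↥(maximalRealSubfield L)) ↥(maximalRealSubfield L)) : traceZeroAdele ↥(maximalRealSubfield L) L (IsCMField.complexConj L)) : AdeleRing (𝓞 L) L).2 v‖₊ : ℝ≥0) : ℝ) : ℂ) ^ (-z)) ∂μf =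
      (∏ v ∈ S, (((((νv v (v.adicCompletionIntegers ↥(maximalRealSubfield L))).toReal⁻¹ : ℝ)) : ℂ) * ∫ x, ω v x * ((((letI := Extension.fintype (𝓞 ↥(maximalRealSubfield L)) ↥(maximalRealSubfield L) L (𝓞 L) v; ∏ w : v.Extension (𝓞 L), max 1 (normAbs (w.1.adicCompletion L) (Extension.adicCompletionSemialgHom ↥(maximalRealSubfield L) L w x) * normAbs (w.1.adicCompletion L) ((algebraMap L (FiniteAdeleRing (𝓞 L) L) δ) w.1))) : ℝ≥0) : ℝ) : ℂ) ^ (-z) ∂νv v)) *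
        (partialStandardL (↑S : Set (HeightOneSpectrum (𝓞 ↥(maximalRealSubfield L)))) (fun v => {ε.valueAtUniformizer v}) (2 * z - 1) /
          partialStandardL (↑S : Set (HeightOneSpectrum (𝓞 ↥(maximalRealSubfield L)))) (fun v => {ε.valueAtUniformizer v}) (2 * z)) := by
  have hall := hasProd_chiLocalMean L hij hN hcδ hδ νv ω hz hωc hωb μf S hS hω1
  simp only [Complex.real_smul] at hall
  -- on `S`: the finite product; off `S`: ★ p861632 through the letter (T)
  have hS' : HasProd ((fun v : HeightOneSpectrum (𝓞 ↥(maximalRealSubfield L)) => (((((νv v (v.adicCompletionIntegers ↥(maximalRealSubfield L))).toReal⁻¹ : ℝ)) : ℂ) * ∫ x, ω v x * ((((letI := Extension.fintype (𝓞 ↥(maximalRealSubfield L)) ↥(maximalRealSubfield L) L (𝓞 L) v; ∏ w : v.Extension (𝓞 L), max 1 (normAbs (w.1.adicCompletion L) (Extension.adicCompletionSemialgHom ↥(maximalRealSubfield L) L w x) * normAbs (w.1.adicCompletion L) ((algebraMap L (FiniteAdeleRing (𝓞 L) L) δ) w.1))) : ℝ≥0) : ℝ) : ℂ) ^ (-z)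 ∂νv v)) ∘ (↑) : (↑S : Set (HeightOneSpectrum (𝓞 ↥(maximalRealSubfield L)))) → ℂ)
      (∏ v ∈ S, (((((νv v (v.adicCompletionIntegers ↥(maximalRealSubfield L))).toReal⁻¹ : ℝ)) : ℂ) * ∫ x, ω v x * ((((letI := Extension.fintype (𝓞 ↥(maximalRealSubfield L)) ↥(maximalRealSubfield L) L (𝓞 L) v; ∏ w : v.Extension (𝓞 L), max 1 (normAbs (w.1.adicCompletion L) (Extension.adicCompletionSemialgHom ↥(maximalRealSubfield L) L w x) * normAbs (w.1.adicCompletion L) ((algebraMap L (FiniteAdeleRing (𝓞 L) L) δ) w.1))) : ℝ≥0) : ℝ) : ℂ) ^ (-z) ∂νv v)) := S.hasProd _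
  have hoff := (hasProd_chiLocalScalar (ε := ε) (S := (↑S : Set (HeightOneSpectrum (𝓞 ↥(maximalRealSubfield L))))) hε hz).1
  have hfun : ((fun v : HeightOneSpectrum (𝓞 ↥(maximalRealSubfield L)) => (((((νv v (v.adicCompletionIntegers ↥(maximalRealSubfield L))).toReal⁻¹ : ℝ)) : ℂ) * ∫ x, ω v x * ((((letI := Extension.fintype (𝓞 ↥(maximalRealSubfield L)) ↥(maximalRealSubfield L) L (𝓞 L) v; ∏ w : v.Extension (𝓞 L), max 1 (normAbs (w.1.adicCompletion L) (Extension.adicCompletionSemialgHom ↥(maximalRealSubfield L) L w x) * normAbs (w.1.adicCompletion L) ((algebraMap L (FiniteAdeleRing (𝓞 L) L) δ) w.1))) : ℝ≥0) : ℝ) : ℂ) ^ (-z) ∂νv v)) ∘ (↑) : ↥((↑S : Set (HeightOneSpectrum (𝓞 ↥(maximalRealSubfield L))))ᶜ) → ℂ) =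
      fun v : {v : HeightOneSpectrum (𝓞 ↥(maximalRealSubfield L)) // v ∉ (↑S : Set (HeightOneSpectrum (𝓞 ↥(maximalRealSubfield L))))} => (1 - ε.valueAtUniformizer v.1 * (v.1.residueCard : ℂ) ^ (-(2 * z))) * (1 - ε.valueAtUniformizer v.1 * (v.1.residueCard : ℂ) ^ (-(2 * z - 1)))⁻¹ := by
    funext v
    exact htok v.1 fun h => v.2 (Finset.mem_coe.2 h)
  have hoff' : HasProd ((fun v : HeightOneSpectrum (𝓞 ↥(maximalRealSubfield L)) => (((((νv v (v.adicCompletionIntegers ↥(maximalRealSubfield L))).toReal⁻¹ : ℝ)) : ℂ) * ∫ x, ω v x * ((((letI := Extension.fintype (𝓞 ↥(maximalRealSubfield L)) ↥(maximalRealSubfield L) L (𝓞 L) v; ∏ w : v.Extension (𝓞 L), max 1 (normAbs (w.1.adicCompletion L) (Extension.adicCompletionSemialgHom ↥(maximalRealSubfield L) L w x) * normAbs (w.1.adicCompletion L) ((algebraMap L (FiniteAdeleRing (𝓞 L) L) δ) w.1))) : ℝ≥0) : ℝ) : ℂ) ^ (-z) ∂νv v)) ∘ (↑) : ↥((↑S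 : Set (HeightOneSpectrum (𝓞 ↥(maximalRealSubfield L))))ᶜ) → ℂ)
      (partialStandardL (↑S : Set (HeightOneSpectrum (𝓞 ↥(maximalRealSubfield L)))) (fun v => {ε.valueAtUniformizer v}) (2 * z - 1) /
          partialStandardL (↑S : Set (HeightOneSpectrum (𝓞 ↥(maximalRealSubfield L)))) (fun v => {ε.valueAtUniformizer v}) (2 * z)) := by
    rw [hfun]; exact hoff
  exact hall.unique (hS'.mul_compl hoff')

end Finite

/-! ## §5 The line integral at complex `z` with the weight letter (W), and the HEAD -/

section Assembly

variable [MeasurableSpace (quasiSplit (↥(maximalRealSubfield L)) L (IsCMField.complexConj L) 2).Adelic] [BorelSpace (quasiSplit (↥(maximalRealSubfield L)) L (IsCMField.complexConj L) 2).Adelic]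
  [MeasurableSpace (FiniteAdeleRing (𝓞 ↥(maximalRealSubfield L)) ↥(maximalRealSubfield L))] [BorelSpace (FiniteAdeleRing (𝓞 ↥(maximalRealSubfield L)) ↥(maximalRealSubfield L))]

omit [∀ v : HeightOneSpectrum (𝓞 ↥(maximalRealSubfield L)), MeasurableSpace (v.adicCompletion ↥(maximalRealSubfield L))] [∀ v : HeightOneSpectrum (𝓞 ↥(maximalRealSubfield L)), BorelSpace (v.adicCompletion ↥(maximalRealSubfield L))] [MeasurableSpace (quasiSplit (↥(maximalRealSubfield L)) L (IsCMField.complexConj L) 2).Adelic] [BorelSpace (quasiSplit (↥(maximalRealSubfield L)) L (IsCMField.complexConj L) 2).Adelic] [MeasurableSpace (FiniteAdeleRing (𝓞 ↥(maximalRealSubfield L)) ↥(maximalRealSubfield L))] [BorelSpace (FiniteAdeleRing (𝓞 ↥(maximalRealSubfield L)) ↥(maximalRealSubfield L))] in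
include hij hN in
/-- **THE HEIGHT ALONG THE LINE AT COMPLEX `z`: `(H(w₀·n(θ(ι⁻¹ s, b))))^z = A(s)^{−z} · h_f(b)^{−z}`** in `ℂ` (★ `borelHeight_weylLongU_line_rpow_eq_cm_two` at `σ = 1` gives
`H = A⁻¹·h_f⁻¹`; then `Complex.mul_cpow_ofReal_nonneg` and `a⁻¹ ^ z = a ^ (−z)` for positive reals). [cite: MoeglinWaldspurger1995, II.1.6] -/
theorem coe_borelHeight_weylLongU_line_cpow_eq_cm_two (z : ℂ) (s : mixedSpace ↥(maximalRealSubfield L)) (b : FiniteAdeleRing (𝓞 ↥(maximalRealSubfield L)) ↥(maximalRealSubfield L)) :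
    ((borelHeight (((quasiSplit (↥(maximalRealSubfield L)) L (IsCMField.complexConj L) 2).toAdelic (weylLongU ((IsCMField.complexConj L : L ≃ₐ[↥(maximalRealSubfield L)] L) : L →+* L) (rfl : ((StdForm.antidiagonal 2).over L) = ((StdForm.antidiagonal 2).over L)))) * (((middleRootUnipotent hij hN (Multiplicative.ofAdd (traceZeroLine ↥(maximalRealSubfield L) L (IsCMField.complexConj L) hcδ hδ (((InfiniteAdeleRing.ringEquiv_mixedSpace ↥(maximalRealSubfield L)).symm s, b) : AdeleRing (𝓞 ↥(maximalRealSubfield L)) ↥(maximalRealSubfield L))))) : ↥(adelicUnipotent (↥(maximalRealSubfield L)) L (IsCMField.complexConj L) 2)) : (quasiSplit (↥(maximalRealSubfield L)) L (IsCMField.complexConj L) 2).Adelic)) : ℝ) : ℂ) ^ z =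
      (((∏ w : InfinitePlace L, ((1 : ℝ) + (w δ) ^ 2 * (s.1 ⟨w.comap (algebraMap ↥(maximalRealSubfield L) L), K2E1HeightBigCellLineFormulaU2.isReal_comap_maximalRealSubfield L w⟩) ^ 2) : ℝ) : ℂ) ^ (-z)) * ((((∏ᶠ v : HeightOneSpectrum (𝓞 L), max 1 ‖((traceZeroLine ↥(maximalRealSubfield L) L (IsCMField.complexConj L) hcδ hδ ((0, b) : AdeleRing (𝓞 ↥(maximalRealSubfield L)) ↥(maximalRealSubfield L)) : traceZeroAdele ↥(maximalRealSubfield L) L (IsCMField.complexConj L)) : AdeleRing (𝓞 L) L).2 v‖₊ : ℝ≥0) : ℝ) : ℂ) ^ (-z)) := by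
  have h1 := borelHeight_weylLongU_line_rpow_eq_cm_two L hij hN hcδ hδ 1 s b
  rw [Real.rpow_one, Real.rpow_neg_one, Real.rpow_neg_one] at h1
  have hA := archFactor_pos L (δ := δ) s
  have hF : (0 : ℝ) < ((∏ᶠ v : HeightOneSpectrum (𝓞 L), max 1 ‖((traceZeroLine ↥(maximalRealSubfield L) L (IsCMField.complexConj L) hcδ hδ ((0, b) : AdeleRing (𝓞 ↥(maximalRealSubfield L)) ↥(maximalRealSubfield L)) : traceZeroAdele ↥(maximalRealSubfield L) L (IsCMField.complexConj L)) : AdeleRing (𝓞 L) L).2 v‖₊ : ℝ≥0) : ℝ) :=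
    lt_of_lt_of_le one_pos (one_le_coe_finprod_line_cm_two L hcδ hδ b)
  rw [h1, Complex.ofReal_mul, Complex.mul_cpow_ofReal_nonneg (inv_nonneg.2 hA.le) (inv_nonneg.2 hF.le), ofReal_inv_cpow hA, ofReal_inv_cpow hF]

omit [∀ v : HeightOneSpectrum (𝓞 ↥(maximalRealSubfield L)), MeasurableSpace (v.adicCompletion ↥(maximalRealSubfield L))] [∀ v : HeightOneSpectrum (𝓞 ↥(maximalRealSubfield L)), BorelSpace (v.adicCompletion ↥(maximalRealSubfield L))] in
include hij hN in
/-- **THE CANONICALLY NORMALISED `χ`-WEIGHTED LINE INTEGRAL (any `z`, no integrability needed)**: for EVERY Haar `ν` of `N(𝔸)`, EVERY fundamental domain `𝓕` of `N(L⁺)`, additive Haar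
`μ_E`, `μ_f`, and the weight letter (W) `φ(w₀·n(θ(ι⁻¹ s, b))) = ω_∞(s)·∏ᶠ_v ω_v(b_v)`:
`ν(𝓕)⁻¹ · ∫_{N(𝔸)} f_z(w₀ v) dν(v) = (μ_E(D_∞)·μ_f(𝒪̂))⁻¹ · (∫ ω_∞·A^{−z} dμ_E) · (∫ (∏ᶠ_v ω_v(b_v))·h_f(b)^{−z} dμ_f)` (★ `inv_mul_integral_eq_inv_mul_integral_traceZeroLine_two` at
`μ_A := ψ_*(μ_E × μ_f)`, Tate's `μ_A(D_{L⁺}) = μ_E(D_∞)·μ_f(𝒪̂)` ★ `preimage_split_adeleFundamentalDomain`, the previous lemma, Fubini `integral_prod_mul`). [cite: TateThesis1967, Thm 4.1.3]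
[cite: MoeglinWaldspurger1995, II.1.6] [cite: Rogawski1990, §13.9 p. 229] -/
theorem inv_measure_mul_integral_flatSectionU_weylLongU_eq_cm_two (z : ℂ) (φ : (quasiSplit (↥(maximalRealSubfield L)) L (IsCMField.complexConj L) 2).Adelic → ℂ) (ωinf : mixedSpace ↥(maximalRealSubfield L) → ℂ)
    (hW : ∀ (s : mixedSpace ↥(maximalRealSubfield L)) (b : FiniteAdeleRing (𝓞 ↥(maximalRealSubfield L)) ↥(maximalRealSubfield L)),
      φ (((quasiSplit (↥(maximalRealSubfield L)) L (IsCMField.complexConj L) 2).toAdelic (weylLongU ((IsCMField.complexConj L : L ≃ₐ[↥(maximalRealSubfield L)] L) : L →+* L) (rfl : ((StdForm.antidiagonal 2).over L) = ((StdForm.antidiagonal 2).over L)))) * (((middleRootUnipotent hij hN (Multiplicative.ofAdd (traceZeroLine ↥(maximalRealSubfield L) L (IsCMField.complexConj L) hcδ hδ (((InfiniteAdeleRing.ringEquiv_mixedSpace ↥(maximalRealSubfield L)).symm s, b) : AdeleRing (𝓞 ↥(maximalRealSubfield L)) ↥(maximalRealSubfield L))))) : ↥(adelicUnipotent (↥(maximalRealSubfield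 L)) L (IsCMField.complexConj L) 2)) : (quasiSplit (↥(maximalRealSubfield L)) L (IsCMField.complexConj L) 2).Adelic)) = ωinf s * ∏ᶠ v : HeightOneSpectrum (𝓞 ↥(maximalRealSubfield L)), ω v (b v))
    (ν : Measure ↥(adelicUnipotent (↥(maximalRealSubfield L)) L (IsCMField.complexConj L) 2)) [ν.IsHaarMeasure]
    {𝓕 : Set ↥(adelicUnipotent (↥(maximalRealSubfield L)) L (IsCMField.complexConj L) 2)} (h𝓕 : IsFundamentalDomain ↥(rationalUnipotent (↥(maximalRealSubfield L)) L (IsCMField.complexConj L) 2) 𝓕 ν)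
    (μE : Measure (mixedSpace ↥(maximalRealSubfield L))) [μE.IsAddHaarMeasure] (μf : Measure (FiniteAdeleRing (𝓞 ↥(maximalRealSubfield L)) ↥(maximalRealSubfield L))) [μf.IsAddHaarMeasure] :
    ((((ν 𝓕).toReal⁻¹ : ℝ)) : ℂ) * ∫ v, flatSectionU φ z (((quasiSplit (↥(maximalRealSubfield L)) L (IsCMField.complexConj L) 2).toAdelic (weylLongU ((IsCMField.complexConj L : L ≃ₐ[↥(maximalRealSubfield L)] L) : L →+* L) (rfl : ((StdForm.antidiagonal 2).over L) = ((StdForm.antidiagonal 2).over L)))) * (v : (quasiSplit (↥(maximalRealSubfield L)) L (IsCMField.complexConj L) 2).Adelic)) ∂ν =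
      (((((μE (ZSpan.fundamentalDomain (latticeBasis ↥(maximalRealSubfield L)))).toReal * (μf {b : FiniteAdeleRing (𝓞 ↥(maximalRealSubfield L)) ↥(maximalRealSubfield L) | ∀ v, b v ∈ v.adicCompletionIntegers ↥(maximalRealSubfield L)}).toReal)⁻¹ : ℝ)) : ℂ) *
        ((∫ s, ωinf s * (((∏ w : InfinitePlace L, ((1 : ℝ) + (w δ) ^ 2 * (s.1 ⟨w.comap (algebraMap ↥(maximalRealSubfield L) L), K2E1HeightBigCellLineFormulaU2.isReal_comap_maximalRealSubfield L w⟩) ^ 2) : ℝ) : ℂ) ^ (-z)) ∂μE) *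
          ∫ b, (∏ᶠ v : HeightOneSpectrum (𝓞 ↥(maximalRealSubfield L)), ω v (b v)) *
            ((((∏ᶠ v : HeightOneSpectrum (𝓞 L), max 1 ‖((traceZeroLine ↥(maximalRealSubfield L) L (IsCMField.complexConj L) hcδ hδ ((0, b) : AdeleRing (𝓞 ↥(maximalRealSubfield L)) ↥(maximalRealSubfield L)) : traceZeroAdele ↥(maximalRealSubfield L) L (IsCMField.complexConj L)) : AdeleRing (𝓞 L) L).2 v‖₊ : ℝ≥0) : ℝ) : ℂ) ^ (-z)) ∂μf) := by
  letI : MeasurableSpace (AdeleRing (𝓞 L) L) := borel _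
  haveI : BorelSpace (AdeleRing (𝓞 L) L) := ⟨rfl⟩
  letI : MeasurableSpace (AdeleRing (𝓞 ↥(maximalRealSubfield L)) ↥(maximalRealSubfield L)) := borel _
  haveI : BorelSpace (AdeleRing (𝓞 ↥(maximalRealSubfield L)) ↥(maximalRealSubfield L)) := ⟨rfl⟩
  haveI := locallyCompactSpace_adeleRing' L
  haveI := locallyCompactSpace_adelicUnipotent_two (F := ↥(maximalRealSubfield L)) (E := L) (c := IsCMField.complexConj L)
  haveI : SecondCountableTopology (FiniteAdeleRing (𝓞 ↥(maximalRealSubfield L)) ↥(maximalRealSubfield L)) := secondCountableTopology_finiteAdeleRing ↥(maximalRealSubfield L)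
  haveI : LocallyCompactSpace (FiniteAdeleRing (𝓞 ↥(maximalRealSubfield L)) ↥(maximalRealSubfield L)) := locallyCompactSpace_finiteAdeleRing' ↥(maximalRealSubfield L)
  haveI : BorelSpace (mixedSpace ↥(maximalRealSubfield L) × FiniteAdeleRing (𝓞 ↥(maximalRealSubfield L)) ↥(maximalRealSubfield L)) := Prod.borelSpace
  haveI : (μE.prod μf).IsAddHaarMeasure := Measure.prod.instIsAddHaarMeasure μE μf
  have hc : IsCMField.complexConj L * IsCMField.complexConj L = 1 := AlgEquiv.ext fun x => IsCMField.complexConj_apply_apply L x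
  -- the splitting `ψ(s, b) = (ι⁻¹ s, b)` as a homeomorphism and as a continuous additive equivalence onto `𝔸_{L⁺}`
  let ψh : mixedSpace ↥(maximalRealSubfield L) × FiniteAdeleRing (𝓞 ↥(maximalRealSubfield L)) ↥(maximalRealSubfield L) ≃ₜ AdeleRing (𝓞 ↥(maximalRealSubfield L)) ↥(maximalRealSubfield L) :=
    (infiniteAdeleRingHomeomorph ↥(maximalRealSubfield L)).symm.prodCongr (Homeomorph.refl _)
  let ψA : mixedSpace ↥(maximalRealSubfield L) × FiniteAdeleRing (𝓞 ↥(maximalRealSubfield L)) ↥(maximalRealSubfield L) ≃ₜ+ AdeleRing (𝓞 ↥(maximalRealSubfield L)) ↥(maximalRealSubfield L) :=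
    ContinuousAddEquiv.mk' ψh fun x y => Prod.ext (map_add (InfiniteAdeleRing.ringEquiv_mixedSpace ↥(maximalRealSubfield L)).symm x.1 y.1) rfl
  haveI hμA : ((μE.prod μf).map ψh).IsAddHaarMeasure := ContinuousAddEquiv.isAddHaarMeasure_map (μE.prod μf) ψA
  -- Tate: `μ_A(D_{L⁺}) = μ_E(D_∞)·μ_f(𝒪̂)`
  have hpre : ⇑ψh ⁻¹' adeleFundamentalDomain ↥(maximalRealSubfield L) = (ZSpan.fundamentalDomain (latticeBasis ↥(maximalRealSubfield L))) ×ˢ {b : FiniteAdeleRing (𝓞 ↥(maximalRealSubfield L)) ↥(maximalRealSubfield L) | ∀ v, b v ∈ v.adicCompletionIntegers ↥(maximalRealSubfield L)} :=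
    preimage_split_adeleFundamentalDomain L
  have hD : ((μE.prod μf).map ψh) (adeleFundamentalDomain ↥(maximalRealSubfield L)) = μE (ZSpan.fundamentalDomain (latticeBasis ↥(maximalRealSubfield L))) * μf {b : FiniteAdeleRing (𝓞 ↥(maximalRealSubfield L)) ↥(maximalRealSubfield L) | ∀ v, b v ∈ v.adicCompletionIntegers ↥(maximalRealSubfield L)} := by
    rw [Measure.map_apply ψh.measurable (measurableSet_adeleFundamentalDomain _), hpre, Measure.prod_prod]
  -- ★ the `𝔸_F`-reading at `μ_A := ψ_*(μ_E × μ_f)` for the flat section along `w₀ N(𝔸)`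
  have key := inv_mul_integral_eq_inv_mul_integral_traceZeroLine_two hij hN hcδ hδ hc ((μE.prod μf).map ψh) ν h𝓕
    (fun v => flatSectionU φ z (((quasiSplit (↥(maximalRealSubfield L)) L (IsCMField.complexConj L) 2).toAdelic (weylLongU ((IsCMField.complexConj L : L ≃ₐ[↥(maximalRealSubfield L)] L) : L →+* L) (rfl : ((StdForm.antidiagonal 2).over L) = ((StdForm.antidiagonal 2).over L)))) * (v : (quasiSplit (↥(maximalRealSubfield L)) L (IsCMField.complexConj L) 2).Adelic)))
  rw [ψh.measurableEmbedding.integral_map, hD] at key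
  -- the integrand along the line: weight letter (W) × height at complex `z`, then Fubini for a product function
  have hpt : ∀ p : mixedSpace ↥(maximalRealSubfield L) × FiniteAdeleRing (𝓞 ↥(maximalRealSubfield L)) ↥(maximalRealSubfield L),
      flatSectionU φ z (((quasiSplit (↥(maximalRealSubfield L)) L (IsCMField.complexConj L) 2).toAdelic (weylLongU ((IsCMField.complexConj L : L ≃ₐ[↥(maximalRealSubfield L)] L) : L →+* L) (rfl : ((StdForm.antidiagonal 2).over L) = ((StdForm.antidiagonal 2).over L)))) * (((middleRootUnipotent hij hN (Multiplicative.ofAdd (traceZeroLine ↥(maximalRealSubfield L) L (IsCMField.complexConj L) hcδ hδ (ψh p))) : ↥(adelicUnipotent (↥(maximalRealSubfield L)) L (IsCMField.complexConj L) 2)) : (quasiSplit (↥(maximalRealSubfield L)) L (IsCMField.complexConj L) 2).Adelic))) =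
        (ωinf p.1 * (((∏ w : InfinitePlace L, ((1 : ℝ) + (w δ) ^ 2 * (p.1.1 ⟨w.comap (algebraMap ↥(maximalRealSubfield L) L), K2E1HeightBigCellLineFormulaU2.isReal_comap_maximalRealSubfield L w⟩) ^ 2) : ℝ) : ℂ) ^ (-z))) *
          ((∏ᶠ v : HeightOneSpectrum (𝓞 ↥(maximalRealSubfield L)), ω v (p.2 v)) * ((((∏ᶠ v : HeightOneSpectrum (𝓞 L), max 1 ‖((traceZeroLine ↥(maximalRealSubfield L) L (IsCMField.complexConj L) hcδ hδ ((0, p.2) : AdeleRing (𝓞 ↥(maximalRealSubfield L)) ↥(maximalRealSubfield L)) : traceZeroAdele ↥(maximalRealSubfield L) L (IsCMField.complexConj L)) : AdeleRing (𝓞 L) L).2 v‖₊ : ℝ≥0) : ℝ) : ℂ) ^ (-z))) := fun p => by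
    show flatSectionU φ z (((quasiSplit (↥(maximalRealSubfield L)) L (IsCMField.complexConj L) 2).toAdelic (weylLongU ((IsCMField.complexConj L : L ≃ₐ[↥(maximalRealSubfield L)] L) : L →+* L) (rfl : ((StdForm.antidiagonal 2).over L) = ((StdForm.antidiagonal 2).over L)))) * (((middleRootUnipotent hij hN (Multiplicative.ofAdd (traceZeroLine ↥(maximalRealSubfield L) L (IsCMField.complexConj L) hcδ hδ (((InfiniteAdeleRing.ringEquiv_mixedSpace ↥(maximalRealSubfield L)).symm p.1, p.2) : AdeleRing (𝓞 ↥(maximalRealSubfield L)) ↥(maximalRealSubfield L))))) : ↥(adelicUnipotent (↥(maximalRealSubfield L)) L (IsCMField.complexConj L) 2)) : (quasiSplit (↥(maximalRealSubfield L)) L (IsCMField.complexConj L) 2).Adelic)) = _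
    rw [flatSectionU_apply, hW p.1 p.2, coe_borelHeight_weylLongU_line_cpow_eq_cm_two L hij hN hcδ hδ z p.1 p.2]
    ring
  have hint : ∫ p : mixedSpace ↥(maximalRealSubfield L) × FiniteAdeleRing (𝓞 ↥(maximalRealSubfield L)) ↥(maximalRealSubfield L),
      flatSectionU φ z (((quasiSplit (↥(maximalRealSubfield L)) L (IsCMField.complexConj L) 2).toAdelic (weylLongU ((IsCMField.complexConj L : L ≃ₐ[↥(maximalRealSubfield L)] L) : L →+* L) (rfl : ((StdForm.antidiagonal 2).over L) = ((StdForm.antidiagonal 2).over L)))) * (((middleRootUnipotent hij hN (Multiplicative.ofAdd (traceZeroLine ↥(maximalRealSubfield L) L (IsCMField.complexConj L) hcδ hδ (ψh p))) : ↥(adelicUnipotent (↥(maximalRealSubfield L)) L (IsCMField.complexConj L) 2)) : (quasiSplit (↥(maximalRealSubfield L)) L (IsCMField.complexConj L) 2).Adelic))) ∂(μE.prod μf) =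
      (∫ s, ωinf s * (((∏ w : InfinitePlace L, ((1 : ℝ) + (w δ) ^ 2 * (s.1 ⟨w.comap (algebraMap ↥(maximalRealSubfield L) L), K2E1HeightBigCellLineFormulaU2.isReal_comap_maximalRealSubfield L w⟩) ^ 2) : ℝ) : ℂ) ^ (-z)) ∂μE) *
        ∫ b, (∏ᶠ v : HeightOneSpectrum (𝓞 ↥(maximalRealSubfield L)), ω v (b v)) *
            ((((∏ᶠ v : HeightOneSpectrum (𝓞 L), max 1 ‖((traceZeroLine ↥(maximalRealSubfield L) L (IsCMField.complexConj L) hcδ hδ ((0, b) : AdeleRing (𝓞 ↥(maximalRealSubfield L)) ↥(maximalRealSubfield L)) : traceZeroAdele ↥(maximalRealSubfield L) L (IsCMField.complexConj L)) : AdeleRing (𝓞 L) L).2 v‖₊ : ℝ≥0) : ℝ) : ℂ) ^ (-z)) ∂μf := by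
    rw [← integral_prod_mul]
    exact integral_congr_ae (Eventually.of_forall hpt)
  rw [hint, ENNReal.toReal_mul] at key
  exact key

include hij hN in
/-- **HEAD — THE EULER PRODUCT OF THE `χ`-TWISTED `U(J₂)` INTERTWINING SCALAR AT COMPLEX `z` (road J2′-1).**  CM pair `L∕L⁺`, `N = 2`, `δ ∈ L⁻∖0`, finset `S ⊇ S_δ`; `Re z > 1`; a unitary
Hecke character `ε` of `L⁺` (read `χ₀`); `φ : G(𝔸) → ℂ` (the values of the `χ`-section), local weights (ω) with `ω_v` continuous, `‖ω_v‖ ≤ 1`, `ω_v = 1` on `𝒪_v` off `S`, an archimedean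
weight `ω_∞`, the dictionary letter (W) and the unramified token letter (T).  THEN, for EVERY Haar `ν` of `N(𝔸)`, EVERY fundamental domain `𝓕` of `N(L⁺)`, additive Haar `μ_E`, `μ_f`, `νv`:
`ν(𝓕)⁻¹ · ∫_{N(𝔸)} f_z(w₀ v) dν(v) = [μ_E(D_∞)⁻¹·∫ ω_∞(s)·A(s)^{−z} dμ_E(s)] · (∏_{v ∈ S} νv(𝒪_v)⁻¹·∫ ω_v·P_v^{−z} dνv) · L^S(2z−1, ε)∕L^S(2z, ε)`
— the right-hand side of ★ p861868's `hsrc` with `A := c_∞ · ∏_{v∈S} m_v` (in ★ p861744's token shapes); the left-hand side is the socket's tube clause at `g = 1`.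
[cite: MoeglinWaldspurger1995, II.1.6] [cite: Langlands1976, Appendix] [cite: TateThesis1967, Thm 3.3.1] [cite: Rogawski1990, §13.9 p. 229] -/
theorem inv_measure_mul_chiIntertwiningScalar_eq_eulerProduct (hz : 1 < z.re) (hωc : ∀ v, Continuous (ω v)) (hωb : ∀ v x, ‖ω v x‖ ≤ 1)
    (S : Finset (HeightOneSpectrum (𝓞 ↥(maximalRealSubfield L)))) (hS : ∀ v ∉ S, ∀ w : v.Extension (𝓞 L), normAbs (w.1.adicCompletion L) ((algebraMap L (FiniteAdeleRing (𝓞 L) L) δ) w.1) = 1)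
    (hω1 : ∀ v ∉ S, ∀ x ∈ v.adicCompletionIntegers ↥(maximalRealSubfield L), ω v x = 1)
    {ε : HeckeCharacter ↥(maximalRealSubfield L)} (hε : ε.IsUnitary)
    (htok : ∀ v ∉ S, (((((νv v (v.adicCompletionIntegers ↥(maximalRealSubfield L))).toReal⁻¹ : ℝ)) : ℂ) * ∫ x, ω v x * ((((letI := Extension.fintype (𝓞 ↥(maximalRealSubfield L)) ↥(maximalRealSubfield L) L (𝓞 L) v; ∏ w : v.Extension (𝓞 L), max 1 (normAbs (w.1.adicCompletion L) (Extension.adicCompletionSemialgHom ↥(maximalRealSubfield L) L w x) * normAbs (w.1.adicCompletion L) ((algebraMap L (FiniteAdeleRing (𝓞 L) L) δ) w.1))) : ℝ≥0) : ℝ) : ℂ) ^ (-z) ∂νv v) =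
      (1 - ε.valueAtUniformizer v * (v.residueCard : ℂ) ^ (-(2 * z))) * (1 - ε.valueAtUniformizer v * (v.residueCard : ℂ) ^ (-(2 * z - 1)))⁻¹)
    (φ : (quasiSplit (↥(maximalRealSubfield L)) L (IsCMField.complexConj L) 2).Adelic → ℂ) (ωinf : mixedSpace ↥(maximalRealSubfield L) → ℂ)
    (hW : ∀ (s : mixedSpace ↥(maximalRealSubfield L)) (b : FiniteAdeleRing (𝓞 ↥(maximalRealSubfield L)) ↥(maximalRealSubfield L)),
      φ (((quasiSplit (↥(maximalRealSubfield L)) L (IsCMField.complexConj L) 2).toAdelic (weylLongU ((IsCMField.complexConj L : L ≃ₐ[↥(maximalRealSubfield L)] L) : L →+* L) (rfl : ((StdForm.antidiagonal 2).over L) = ((StdForm.antidiagonal 2).over L)))) * (((middleRootUnipotent hij hN (Multiplicative.ofAdd (traceZeroLine ↥(maximalRealSubfield L) L (IsCMField.complexConj L) hcδ hδ (((InfiniteAdeleRing.ringEquiv_mixedSpace ↥(maximalRealSubfield L)).symm s, b) : AdeleRing (𝓞 ↥(maximalRealSubfield L)) ↥(maximalRealSubfield L))))) : ↥(adelicUnipotent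 (↥(maximalRealSubfield L)) L (IsCMField.complexConj L) 2)) : (quasiSplit (↥(maximalRealSubfield L)) L (IsCMField.complexConj L) 2).Adelic)) = ωinf s * ∏ᶠ v : HeightOneSpectrum (𝓞 ↥(maximalRealSubfield L)), ω v (b v))
    (ν : Measure ↥(adelicUnipotent (↥(maximalRealSubfield L)) L (IsCMField.complexConj L) 2)) [ν.IsHaarMeasure]
    {𝓕 : Set ↥(adelicUnipotent (↥(maximalRealSubfield L)) L (IsCMField.complexConj L) 2)} (h𝓕 : IsFundamentalDomain ↥(rationalUnipotent (↥(maximalRealSubfield L)) L (IsCMField.complexConj L) 2) 𝓕 ν)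
    (μE : Measure (mixedSpace ↥(maximalRealSubfield L))) [μE.IsAddHaarMeasure] (μf : Measure (FiniteAdeleRing (𝓞 ↥(maximalRealSubfield L)) ↥(maximalRealSubfield L))) [μf.IsAddHaarMeasure] :
    ((((ν 𝓕).toReal⁻¹ : ℝ)) : ℂ) * ∫ v, flatSectionU φ z (((quasiSplit (↥(maximalRealSubfield L)) L (IsCMField.complexConj L) 2).toAdelic (weylLongU ((IsCMField.complexConj L : L ≃ₐ[↥(maximalRealSubfield L)] L) : L →+* L) (rfl : ((StdForm.antidiagonal 2).over L) = ((StdForm.antidiagonal 2).over L)))) * (v : (quasiSplit (↥(maximalRealSubfield L)) L (IsCMField.complexConj L) 2).Adelic)) ∂ν =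
      (((((μE (ZSpan.fundamentalDomain (latticeBasis ↥(maximalRealSubfield L)))).toReal⁻¹ : ℝ)) : ℂ) *
          ∫ s, ωinf s * (((∏ w : InfinitePlace L, ((1 : ℝ) + (w δ) ^ 2 * (s.1 ⟨w.comap (algebraMap ↥(maximalRealSubfield L) L), K2E1HeightBigCellLineFormulaU2.isReal_comap_maximalRealSubfield L w⟩) ^ 2) : ℝ) : ℂ) ^ (-z)) ∂μE) *
        (∏ v ∈ S, (((((νv v (v.adicCompletionIntegers ↥(maximalRealSubfield L))).toReal⁻¹ : ℝ)) : ℂ) * ∫ x, ω v x * ((((letI := Extension.fintype (𝓞 ↥(maximalRealSubfield L)) ↥(maximalRealSubfield L) L (𝓞 L) v; ∏ w : v.Extension (𝓞 L), max 1 (normAbs (w.1.adicCompletion L) (Extension.adicCompletionSemialgHom ↥(maximalRealSubfield L) L w x) * normAbs (w.1.adicCompletion L) ((algebraMap L (FiniteAdeleRing (𝓞 L) L) δ) w.1))) : ℝ≥0) : ℝ) : ℂ) ^ (-z) ∂νv v)) *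
        (partialStandardL (↑S : Set (HeightOneSpectrum (𝓞 ↥(maximalRealSubfield L)))) (fun v => {ε.valueAtUniformizer v}) (2 * z - 1) /
          partialStandardL (↑S : Set (HeightOneSpectrum (𝓞 ↥(maximalRealSubfield L)))) (fun v => {ε.valueAtUniformizer v}) (2 * z)) := by
  have hfin := inv_measure_mul_integral_chiFinFactor_eq_eulerProduct L hij hN hcδ hδ νv ω hz hωc hωb μf S hS hω1 hε htok
  rw [inv_measure_mul_integral_flatSectionU_weylLongU_eq_cm_two L hij hN hcδ hδ ω z φ ωinf hW ν h𝓕 μE μf, mul_assoc ((((((μE (ZSpan.fundamentalDomain (latticeBasis ↥(maximalRealSubfield L)))).toReal⁻¹ : ℝ)) : ℂ) *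
          ∫ s, ωinf s * (((∏ w : InfinitePlace L, ((1 : ℝ) + (w δ) ^ 2 * (s.1 ⟨w.comap (algebraMap ↥(maximalRealSubfield L) L), K2E1HeightBigCellLineFormulaU2.isReal_comap_maximalRealSubfield L w⟩) ^ 2) : ℝ) : ℂ) ^ (-z)) ∂μE)), ← hfin]
  push_cast
  ring

omit [MeasurableSpace (quasiSplit (↥(maximalRealSubfield L)) L (IsCMField.complexConj L) 2).Adelic] [BorelSpace (quasiSplit (↥(maximalRealSubfield L)) L (IsCMField.complexConj L) 2).Adelic] [MeasurableSpace (FiniteAdeleRing (𝓞 ↥(maximalRealSubfield L)) ↥(maximalRealSubfield L))] [BorelSpace (FiniteAdeleRing (𝓞 ↥(maximalRealSubfield L)) ↥(maximalRealSubfield L))] in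
include hδ in
/-- **`A := c_∞ · ∏_{v∈S} m_v` IS HOLOMORPHIC ON `{½ < Re}`** — the `hA` binder of ★ p861868 `exists_sub_one_mul_qc_eq_of_oneSource`, from ★ p861744 (`differentiableOn_chiArchMean`,
`differentiableOn_chiLocalMean`; measurable weights of modulus `≤ 1`). [cite: MoeglinWaldspurger1995, IV.1.11] [cite: Langlands1976, Appendix] -/
theorem differentiableOn_chiArchMean_mul_prod_chiLocalMean (hωm : ∀ v, Measurable (ω v)) (hωb : ∀ v x, ‖ω v x‖ ≤ 1) (S : Finset (HeightOneSpectrum (𝓞 ↥(maximalRealSubfield L))))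
    (μE : Measure (mixedSpace ↥(maximalRealSubfield L))) [μE.IsAddHaarMeasure] (ωinf : mixedSpace ↥(maximalRealSubfield L) → ℂ) (hωinfm : Measurable ωinf) (hωinfb : ∀ s, ‖ωinf s‖ ≤ 1) :
    DifferentiableOn ℂ (fun z : ℂ =>
      (((((μE (ZSpan.fundamentalDomain (latticeBasis ↥(maximalRealSubfield L)))).toReal⁻¹ : ℝ)) : ℂ) *
          ∫ s, ωinf s * (((∏ w : InfinitePlace L, ((1 : ℝ) + (w δ) ^ 2 * (s.1 ⟨w.comap (algebraMap ↥(maximalRealSubfield L) L), K2E1HeightBigCellLineFormulaU2.isReal_comap_maximalRealSubfield L w⟩) ^ 2) : ℝ) : ℂ) ^ (-z)) ∂μE) *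
        ∏ v ∈ S, (((((νv v (v.adicCompletionIntegers ↥(maximalRealSubfield L))).toReal⁻¹ : ℝ)) : ℂ) * ∫ x, ω v x * ((((letI := Extension.fintype (𝓞 ↥(maximalRealSubfield L)) ↥(maximalRealSubfield L) L (𝓞 L) v; ∏ w : v.Extension (𝓞 L), max 1 (normAbs (w.1.adicCompletion L) (Extension.adicCompletionSemialgHom ↥(maximalRealSubfield L) L w x) * normAbs (w.1.adicCompletion L) ((algebraMap L (FiniteAdeleRing (𝓞 L) L) δ) w.1))) : ℝ≥0) : ℝ) : ℂ) ^ (-z) ∂νv v))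
      {z : ℂ | 1 / 2 < z.re} :=
  (differentiableOn_chiArchMean L hδ μE ωinf hωinfm hωinfb).mul (DifferentiableOn.fun_finsetProd fun v _ => differentiableOn_chiLocalMean L hδ v (νv v) (ω v) (hωm v) (hωb v))

end Assembly

end Summit.HodgeConjecture.HodgeConjecture.Cruxes.H413.K2E1ChiIntertwiningScalarEulerProductU2

end
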